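import Summits.QuantumAdvantage.QuantumAdvantage.Statement
import Literature.Computability.QuantumComplexity.RandomOracleZeroOne
import Literature.Computability.Cryptography.ClassBQP
import HarnessLib

/-!
# `QuantumAdvantage` implies `P^A ≠ BQP^A` for almost every oracle `A`

Sequel to `SoloBlindMeasureOne.lean`. With the zero-one law for the event `{A | L ∈ P^A}`
(`Literature.Computability.QuantumComplexity.ae_mem_PRel_or_ae_not_mem`,
`not_mem_almostP_iff_ae_not_mem`; Bennett–Gill 1981, Lemma 1) the measure-one rung takes its
printed "with probability 1" form:

* `soloBlind_measure_setOf_mem_PRel_eq_one_of_mem_BPP` / `…_eq_zero_of_not_mem_BPP`: for EVERY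
  language `L`, `Pr_A[L ∈ P^A]` is `1` if `L ∈ BPP` and `0` otherwise (Bennett–Gill's
  `ALMOST-P = BPP`, both inclusions discharged in the tree, plus the zero-one law);
* `soloBlind_quantumAdvantage_iff_exists_ae_not_mem_PRel`: the summit is equivalent to "some
  `BQP` language lies outside `P^A` for almost every oracle `A`";
* `soloBlind_measureOne_separation`: the summit implies `BQP^A ⊄ P^A` for almost every `A` —
  i.e. `BQP ≠ BPP ⟹ (P^A ≠ BQP^A with probability 1)`, the contrapositive of Fortnow–Rogers 1999,
  Thm. 4.4 in its sharp form. Whether `P^A ≠ BQP^A` with probability 1 can be proved is the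
  question Fortnow–Rogers raise (JCSS 59 (1999), §5) and Aaronson–Ambainis argue to be beyond
  present technique (Theory of Computing 10 (2014), §1.1, Thm. 3.5: under their Conjecture 1.7
  and `P = P^#P`, `BQP^A ⊂ AvgP^A` with probability 1).

Nothing here is progress towards the summit: it is the kernel-checked statement that the
random-oracle separation of `P` and `BQP` is a CONSEQUENCE of the summit (a rung below it), the
oracle-dependent witnesses being exactly what the rung allows and the summit forbids.

References: C. H. Bennett, J. Gill, SIAM J. Comput. 10 (1981), Lemma 1 and Thm. 5 (numbering from
memory; not held); L. Fortnow, J. Rogers, J. Comput. System Sci. 59 (1999), Thm. 4.4, §5;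
S. Aaronson, A. Ambainis, Theory of Computing 10 (2014), §1.1, Thm. 3.5, Thm. 3.8.
-/

namespace Summit.QuantumAdvantage.QuantumAdvantage.Theorems

open MeasureTheory Literature.Computability.Complexity Literature.Computability.Complexity.Classes
  Literature.Computability.Cryptography Literature.Computability.QuantumComplexity

/-- For a `BPP` language, `L ∈ P^A` for almost every oracle (Bennett–Gill `BPP ⊆ ALMOST-P`,
discharged in the tree), i.e. `Pr_A[L ∈ P^A] = 1`. -/
theorem soloBlind_measure_setOf_mem_PRel_eq_one_of_mem_BPP {L : Language Bool} (hL : L ∈ BPP) :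
    randomOracleMeasure {A : Set (List Bool) | L ∈ PRel (Oracle.ofLanguage A)} = 1 := by
  rw [← prob_compl_eq_zero_iff (measurableSet_setOf_mem_PRel L), Set.compl_setOf, ← ae_iff]
  exact mem_almostP_iff.1 (BPP_subset_almostP_holds hL)

/-- For a language outside `BPP`, `L ∉ P^A` for almost every oracle, i.e. `Pr_A[L ∈ P^A] = 0`
(Bennett–Gill `ALMOST-P ⊆ BPP`, discharged, and the zero-one law). -/
theorem soloBlind_measure_setOf_mem_PRel_eq_zero_of_not_mem_BPP {L : Language Bool}
    (hL : L ∉ BPP) :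
    randomOracleMeasure {A : Set (List Bool) | L ∈ PRel (Oracle.ofLanguage A)} = 0 := by
  have hLa : L ∉ almostP := fun hA => hL (almostP_subset_BPP_holds hA)
  have hae := (not_mem_almostP_iff_ae_not_mem L).1 hLa
  rw [ae_iff] at hae
  simpa only [not_not] using hae

/-- `Pr_A[L ∈ P^A] = 1 ↔ L ∈ BPP`, for every language `L`. -/
theorem soloBlind_measure_setOf_mem_PRel_eq_one_iff (L : Language Bool) :
    randomOracleMeasure {A : Set (List Bool) | L ∈ PRel (Oracle.ofLanguage A)} = 1 ↔ L ∈ BPP := by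
  refine ⟨fun h => ?_, soloBlind_measure_setOf_mem_PRel_eq_one_of_mem_BPP⟩
  by_contra hL
  rw [soloBlind_measure_setOf_mem_PRel_eq_zero_of_not_mem_BPP hL] at h
  exact zero_ne_one h

/-- **The summit is equivalent to: some `BQP` language lies outside `P^A` for almost every
oracle `A`.** -/
theorem soloBlind_quantumAdvantage_iff_exists_ae_not_mem_PRel :
    _root_.QuantumAdvantage ↔ ∃ L : Language Bool, L ∈ BQP ∧
      ∀ᵐ (A : Set (List Bool)) ∂randomOracleMeasure, L ∉ PRel (Oracle.ofLanguage A) := by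
  show (∃ L : Language Bool, L ∈ BQP ∧ L ∉ BPP) ↔ _
  constructor
  · rintro ⟨L, hL, hL'⟩
    exact ⟨L, hL, (not_mem_almostP_iff_ae_not_mem L).1 fun hA => hL' (almostP_subset_BPP_holds hA)⟩
  · rintro ⟨L, hL, hae⟩
    exact ⟨L, hL, fun hB => (not_mem_almostP_iff_ae_not_mem L).2 hae (BPP_subset_almostP_holds hB)⟩

/-- **`BQP ≠ BPP ⟹ P^A ≠ BQP^A` with probability 1** (Fortnow–Rogers 1999, Thm. 4.4,
contrapositive, sharpened by the zero-one law): under the summit, `BQP^A ⊆ P^A` fails for almost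
every oracle `A` — witnessed by one oracle-free `L ∈ BQP ∖ BPP`, which lies in every `BQP^A`. -/
theorem soloBlind_measureOne_separation (h : _root_.QuantumAdvantage) :
    ∀ᵐ (A : Set (List Bool)) ∂randomOracleMeasure, ¬ (BQPRel A ⊆ PRel (Oracle.ofLanguage A)) := by
  obtain ⟨L, hL, hae⟩ := soloBlind_quantumAdvantage_iff_exists_ae_not_mem_PRel.1 h
  exact hae.mono fun A hA hsub => hA (hsub (BQP_subset_BQPRel A hL))

/-- Witness form: under the summit a single `L ∈ BQP ∖ BPP` is, for almost every oracle `A`, a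
language of `BQP^A ∖ P^A`. -/
theorem soloBlind_measureOne_separation_witness (h : _root_.QuantumAdvantage) :
    ∃ L : Language Bool, L ∈ BQP ∧ L ∉ BPP ∧
      ∀ᵐ (A : Set (List Bool)) ∂randomOracleMeasure,
        L ∈ BQPRel A ∧ L ∉ PRel (Oracle.ofLanguage A) := by
  obtain ⟨L, hL, hL'⟩ := (id h : ∃ L : Language Bool, L ∈ BQP ∧ L ∉ BPP)
  refine ⟨L, hL, hL', ?_⟩
  have hae := (not_mem_almostP_iff_ae_not_mem L).1 fun hA => hL' (almostP_subset_BPP_holds hA)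
  exact hae.mono fun A hA => ⟨BQP_subset_BQPRel A hL, hA⟩

end Summit.QuantumAdvantage.QuantumAdvantage.Theorems
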